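import Summits.BirchSwinnertonDyer.Rank1Residual.Additive.TameBranchExtraZerosRankOne
import Summits.BirchSwinnertonDyer.Rank1Residual.Additive.TameBranchExtraZerosRankZero
import HarnessLib

/-!
# THE PARITY OF `λ` ON THE TAME BRANCH — Λ-algebra: the LOWER sandwich `μ(fE) ≤ v([Tʳ]fE)` (`=` iff
# `λ(fE) = r`), Greenberg's parity `λ(char_Λ X) ≡ rank (mod 2)` for the tame-branch data, and the
# λ-part ⟺ the RATIONAL main-conjecture shape with its exponent IDENTIFIED as `μ(X) + c`
# (cell `b2b-bsdres`, sub-cell additive-p2 = X3♯(G-ord)/X4♯(G-ord), gen 30; part 1)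

HONEST FRAMING (cell `b2b-bsdres`, run/shared/lean/b2b/bsd-rank1-residual/, verbatim in every
file): the goal of the cell is to DELETE the COMBINATION-SHAPED residual classes of the
Birch–Swinnerton-Dyer formula for ALL analytic-rank `≤ 1` elliptic curves over `ℚ` — "full BSD
formula for every rank `≤ 1` curve in class `C`" assembled STRICTLY from published theorems — so
that the rank-`≤ 1` remainder becomes exactly the CONSTRUCTION-SHAPED classes, which are TYPED
(missing-input `Prop`s), NOT attempted. This is not "finishing BSD". Sub-cell additive-p2: the
classes X3♯(G-ord) / X4♯(G-ord) are CONSTRUCTION-SHAPED and stay so; labels / RESIDUAL-MAP marks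
UNCHANGED; nothing is booked. Theorems only (pure algebra of `Λ = ℤ_p⟦T⟧` plus ONE published named
fact as an explicit hypothesis binder: Greenberg, LNM 1716 (1999), Prop. 3.10,
`prop310_selmerCorank_mod_two_eq_lambdaInvariant`, vendored by eisenstein-p1 — NO reduction hypothesis
at `p` in the printed statement); no definition, no named fact minted, no `sorry`.

## What and why

Gen 29 proved, from the RATIONAL Kato half `ι(fE·h) = p^k·B` (Delbourgo 2002 (C)) and a tame branch
`B` bounded by `p^c` with FIRST TOP at `n = λ_an`, the UPPER sandwich
`LHS ≤ μ(fE) + (extra zeros' contribution) + rank + 2 ord #tors`, `=` iff `λ(fE) = λ_an`, where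
`LHS = ord Ш[p^∞] + ord Reg_p + ord ∏c + ord ℓ` is the algebraic side of Delbourgo 2002 (B). This part
adds three pieces of Λ-algebra and one published parity:

* §1 **the LOWER sandwich** `μ(g) ≤ v_p([Tʳ]g)` for `r ≤ λ(g)`, `[Tʳ]g ≠ 0`, with **`=` iff
  `λ(g) = r`** (`mu_le_valuation_coeff`; below `λ(g)` the `p`-free part reduces to `0` mod `p`). Read
  through (B) at `r = rank`: `μ(X) + rank + 2 ord #tors ≤ LHS`, `=` iff `λ(X) = rank` (parts 2–3).
* §2 **the λ-part IS the rational main conjecture at the pair, with the exponent identified**: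
  `g = fE·h`, `ι g = p^k·B`, `λ(fE) = λ(g)` ⟹ the `p`-free part `H` of the cofactor is a UNIT,
  `(fE·H) = (fE)` and `ι(fE·H) = p^{k − μ(h)}·B` (`exists_span_eq_and_iota_eq_zpow_of_lam_eq`); if `B`
  attains its bound `p^c` the exponent is **`μ(fE) + c`** (`iota_eq_pow_mu_add_of_lam_eq`: the INTEGRAL
  E-normalised equality `char_Λ X = (ι⁻¹(p^c·B))` holds iff moreover `μ(X) = 0`); conversely
  `(G) = (fE)`, `ι G = p^k·B` (`k ∈ ℤ`), first top of `B` at `n` ⟹ `λ(fE) = n` and `k = μ(fE) + c`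
  (`lam_eq_and_exponent_eq_of_span_eq_of_iota_eq_zpow`) — Greenberg–Vatsal's remark "λ_alg = λ_an
  implies f_alg and f_an differ by a power of p" in the tame-branch currency.
* §3 **parity**: for a cyclotomic dual datum with `X` torsion, generator `fE ≠ 0` and `#Ш[p^∞] < ∞`:
  **`λ(fE) ≡ rank_ℤ E(ℚ) (mod 2)`** (`lam_generator_mod_two_eq_rank`) — Greenberg Prop. 3.10
  (`corank Sel_{p^∞}(E/ℚ) ≡ λ(X) (mod 2)`, `p` odd, NO reduction hypothesis) + the structure theorem
  (`lam_generator_eq_lambdaInvariant`, eisenstein-p1) + `corank Sel = rank` when `Ш[p^∞]` is finite.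

Parts 2–3 (`TameBranchLambdaParityRankOne/RankZero`) read §1–§3 through Delbourgo 2002 (B): the
TWO-SIDED sandwich, `λ(X) ∈ {rank, rank+2, …} ∩ [rank, λ_an]`, the DICHOTOMY at `λ_an = rank + 2` and
the SQUEEZE (a certified `LHS > μ + rank + 2 ord #tors` forces the λ-part, hence §2's rational main
conjecture at the pair). Nothing booked; labels UNCHANGED.

References: Washington GTM 83 §7.1 [Washington1997]; Greenberg LNM 1716 Prop. 3.10 [GreenbergLNM1716];
Greenberg–Vatsal 2000 p. 4 [GreenbergVatsal2000]; `X1/MuLambdaAlgebra.lean`, `X1/LambdaSqueezeAlgebra.lean`,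
`X1/ParitySqueeze.lean` (eisenstein-p1), `X1/RankOneParitySqueeze.lean` (x1b), `TameBranchExtraZerosLaw.lean`
(gen 29). -/

set_option autoImplicit false

noncomputable section

open scoped Classical MatrixGroups ModularForm NumberField

open CongruenceSubgroup IsDedekindDomain WeierstrassCurve NumberField
  Literature.NumberTheory.EllipticCurves
  Literature.NumberTheory.EllipticCurves.ModularForms
  Literature.NumberTheory.EllipticCurves.Rank1Residual
  Literature.NumberTheory.EllipticCurves.Rank1Residual.Typed
  Literature.NumberTheory.EllipticCurves.Greenberg1999
  Summit.BirchSwinnertonDyer.Rank1Residual.X1.MuLambda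
  Summit.BirchSwinnertonDyer.Rank1Residual.X1.ParitySqueeze
  Summit.BirchSwinnertonDyer.Rank1Residual.X1.RankOneParitySqueeze
  Summit.BirchSwinnertonDyer.Rank1Residual.X11a.LambdaNorm

namespace Summit.BirchSwinnertonDyer.Rank1Residual.Additive

namespace TameBranchLambdaParity

/-! ### §1 The LOWER sandwich: `μ(g) ≤ v_p([Tʳ]g)` for `r ≤ λ(g)`, `=` iff `λ(g) = r` -/

section Lower

variable {p : ℕ} [hp : Fact p.Prime]

/-- Below `λ(g)` the `p`-free part of `g` reduces to zero mod `p`: `‖[Tⁱ] pfree g‖ < 1` for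
`i < λ(g)` (`λ(g) = ord_T (pfree g mod p)`). [cite: Washington1997, §7.1] -/
theorem norm_coeff_pfree_lt_one_of_lt_lam {g : IwasawaAlgebra p} (hg : g ≠ 0) {i : ℕ}
    (hi : i < lam g) : ‖PowerSeries.coeff i (pfree g)‖ < 1 := by
  rw [← coeff_map_residue_eq_zero_iff]
  apply PowerSeries.coeff_of_lt_order
  have hne : (red (pfree g)).order ≠ ⊤ := by
    rw [Ne, PowerSeries.order_eq_top]; exact red_pfree_ne_zero hg
  have e : ((lam g : ℕ) : ℕ∞) = (red (pfree g)).order := by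
    rw [lam]; exact ENat.coe_toNat hne
  rw [← e]
  exact_mod_cast hi

/-- For `i < λ(g)` every NON-ZERO coefficient `[Tⁱ]g` has `v_p ≥ μ(g) + 1`
(`[Tⁱ]g = p^{μ(g)}·[Tⁱ]pfree g` with `p ∣ [Tⁱ]pfree g`). [cite: Washington1997, §7.1] -/
theorem mu_lt_valuation_coeff_of_lt_lam {g : IwasawaAlgebra p} (hg : g ≠ 0) {i : ℕ} (hi : i < lam g)
    (hci : ((PowerSeries.coeff i g : ℤ_[p]) : ℚ_[p]) ≠ 0) :
    (mu g : ℤ) + 1 ≤ (((PowerSeries.coeff i g : ℤ_[p]) : ℚ_[p])).valuation := by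
  have hpQ : (p : ℚ_[p]) ≠ 0 := Nat.cast_ne_zero.mpr hp.out.ne_zero
  have hcZ : PowerSeries.coeff i g = (p : ℤ_[p]) ^ mu g * PowerSeries.coeff i (pfree g) := by
    conv_lhs => rw [eq_C_pow_mu_mul_pfree g]
    rw [PowerSeries.coeff_C_mul]
  have hx0 : ((PowerSeries.coeff i (pfree g) : ℤ_[p]) : ℚ_[p]) ≠ 0 := by
    intro e; apply hci; rw [hcZ]; push_cast; rw [e, mul_zero]
  have hv : (((PowerSeries.coeff i g : ℤ_[p]) : ℚ_[p])).valuation =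
      mu g + ((PowerSeries.coeff i (pfree g) : ℤ_[p]) : ℚ_[p]).valuation := by
    rw [hcZ]; push_cast
    rw [Padic.valuation_mul (pow_ne_zero _ hpQ) hx0, Padic.valuation_pow, Padic.valuation_p, mul_one]
  have hlt := norm_coeff_pfree_lt_one_of_lt_lam hg hi
  have h0 := TameBranchExtraZeros.valuation_coe_nonneg (PowerSeries.coeff i (pfree g))
  have hne : ((PowerSeries.coeff i (pfree g) : ℤ_[p]) : ℚ_[p]).valuation ≠ 0 := by
    intro e
    have h1 : ‖((PowerSeries.coeff i (pfree g) : ℤ_[p]) : ℚ_[p])‖ = (p : ℝ) ^ (0 : ℕ) :=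
      (TameBranchExtraZeros.norm_eq_pow_iff_valuation_eq hx0 0).mpr (by simpa using e)
    rw [pow_zero, PadicInt.padic_norm_e_of_padicInt] at h1
    exact (ne_of_lt hlt) h1
  rw [hv]
  omega

/-- **THE LOWER SANDWICH (Λ-algebra).** For `g ≠ 0`, `r ≤ λ(g)` and `[Tʳ]g ≠ 0`:
**`μ(g) ≤ v_p([Tʳ]g)`, with equality iff `λ(g) = r`** (`[T^{λ(g)}]g = p^{μ(g)}·unit`; below `λ(g)`
the valuation exceeds `μ(g)`). Gen 29's `mu_le_valuation_constantCoeff` is the case `r = 0`.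
[cite: Washington1997, §7.1] -/
theorem mu_le_valuation_coeff {g : IwasawaAlgebra p} (hg : g ≠ 0) {r : ℕ} (hr : r ≤ lam g)
    (hc : ((PowerSeries.coeff r g : ℤ_[p]) : ℚ_[p]) ≠ 0) :
    (mu g : ℤ) ≤ (((PowerSeries.coeff r g : ℤ_[p]) : ℚ_[p])).valuation ∧
      ((mu g : ℤ) = (((PowerSeries.coeff r g : ℤ_[p]) : ℚ_[p])).valuation ↔ lam g = r) := by
  rcases hr.eq_or_lt with h | h
  · obtain ⟨-, hval⟩ := valuation_coeff_lam hg
    rw [← h] at hval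
    exact ⟨hval.ge, ⟨fun _ ↦ h.symm, fun _ ↦ hval.symm⟩⟩
  · have h1 := mu_lt_valuation_coeff_of_lt_lam hg h hc
    refine ⟨by omega, ⟨fun e ↦ by omega, fun e ↦ by omega⟩⟩

/-- Parity bookkeeping: `r ≤ λ ≤ n`, `λ ≡ r (mod 2)` ⟹ `λ = r` or `r + 2 ≤ λ`; at `n = r + 2` this is
the DICHOTOMY `λ ∈ {r, n}`, and at `n ≤ r + 1` it forces `λ = r`. [folklore] -/
theorem eq_or_add_two_le_of_mod_two_eq {lam' r n : ℕ} (hr : r ≤ lam') (hn : lam' ≤ n)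
    (hpar : lam' % 2 = r % 2) :
    (lam' = r ∨ r + 2 ≤ lam') ∧ (n = r + 2 → lam' = r ∨ lam' = n) ∧ (n ≤ r + 1 → lam' = r) := by
  refine ⟨by omega, fun h ↦ by omega, fun h ↦ by omega⟩

end Lower

/-! ### §2 The λ-part ⟺ the RATIONAL main-conjecture shape, exponent `= μ + c` -/

section MainConjShape

variable {p : ℕ} [hp : Fact p.Prime]

/-- The `p`-free part of `h ≠ 0` has `μ = 0` and `λ(pfree h) = λ(h)`. [folklore] -/
theorem mu_pfree_eq_zero_and_lam_pfree_eq {h : IwasawaAlgebra p} (hh : h ≠ 0) :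
    mu (pfree h) = 0 ∧ lam (pfree h) = lam h := by
  have e : pfree h = PowerSeries.C ((p : ℤ_[p]) ^ 0) * pfree h := by
    rw [pow_zero, map_one, one_mul]
  obtain ⟨hμ, hpf⟩ := mu_eq_and_pfree_eq (red_pfree_ne_zero hh) e
  refine ⟨hμ, ?_⟩
  show (red (pfree (pfree h))).order.toNat = (red (pfree h)).order.toNat
  rw [hpf]

/-- **A cofactor without zeros is `p^{μ}·unit`.** If `λ(h) = 0` (`h ≠ 0`) then `pfree h ∈ Λˣ`.
[cite: Washington1997, §7.1] -/
theorem isUnit_pfree_of_lam_eq_zero {h : IwasawaAlgebra p} (hh : h ≠ 0) (h0 : lam h = 0) :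
    IsUnit (pfree h) := by
  obtain ⟨hμ, hlam⟩ := mu_pfree_eq_zero_and_lam_pfree_eq hh
  exact (isUnit_iff_mu_eq_zero_and_lam_eq_zero _).mpr ⟨pfree_ne_zero hh, hμ, by rw [hlam, h0]⟩

/-- **THE λ-PART IS THE RATIONAL MAIN CONJECTURE AT THE PAIR (Λ-algebra).** `g = fE·h ≠ 0`,
`ι g = p^k·B` and `λ(fE) = λ(g)`. Then the `p`-free part `H = pfree h` of the cofactor is a UNIT,
`G := fE·H` generates the same ideal as `fE`, and **`ι G = p^{k − μ(h)}·B`** (integer exponent) —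
Greenberg–Vatsal: "the equality `λ_alg = λ_an` implies that `f_alg` and `f_an` differ by multiplication
by a power of `p`" (up to `Λˣ`). [cite: GreenbergVatsal2000, p. 4 (after Thm. (1.2))]
[cite: Washington1997, §7.1] -/
theorem exists_span_eq_and_iota_eq_zpow_of_lam_eq {fE h g : IwasawaAlgebra p} (hfac : g = fE * h)
    (hg : g ≠ 0) {k : ℕ} {B : PowerSeries ℚ_[p]}
    (hι : iwasawaToPowerSeries p g = PowerSeries.C ((p : ℚ_[p]) ^ k) * B) (hlam : lam fE = lam g) :
    IsUnit (pfree h) ∧ Ideal.span ({fE * pfree h} : Set (IwasawaAlgebra p)) = Ideal.span {fE} ∧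
      mu (fE * pfree h) = mu fE ∧ lam (fE * pfree h) = lam fE ∧
      iwasawaToPowerSeries p (fE * pfree h) =
        PowerSeries.C ((p : ℚ_[p]) ^ ((k : ℤ) - mu h)) * B := by
  have hpQ : (p : ℚ_[p]) ≠ 0 := Nat.cast_ne_zero.mpr hp.out.ne_zero
  have hfE : fE ≠ 0 := by intro h0; apply hg; rw [hfac, h0, zero_mul]
  have hh : h ≠ 0 := by intro h0; apply hg; rw [hfac, h0, mul_zero]
  have hlamh : lam h = 0 := by
    have e : lam g = lam fE + lam h := by rw [hfac]; exact lam_mul hfE hh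
    omega
  have hunit : IsUnit (pfree h) := isUnit_pfree_of_lam_eq_zero hh hlamh
  have hH0 : pfree h ≠ 0 := pfree_ne_zero hh
  obtain ⟨-, hμH, hlamH⟩ := (isUnit_iff_mu_eq_zero_and_lam_eq_zero _).mp hunit
  refine ⟨hunit, (span_eq_span_iff_isUnit hfE rfl).mpr hunit,
    by rw [mu_mul hfE hH0, hμH, add_zero], by rw [lam_mul hfE hH0, hlamH, add_zero], ?_⟩
  -- `g = p^{μ(h)} · (fE · H)`
  have hg' : g = PowerSeries.C ((p : ℤ_[p]) ^ mu h) * (fE * pfree h) := by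
    rw [hfac]
    conv_lhs => rw [eq_C_pow_mu_mul_pfree h]
    ring
  have hιeq : PowerSeries.C ((p : ℚ_[p]) ^ mu h) * iwasawaToPowerSeries p (fE * pfree h) =
      PowerSeries.C ((p : ℚ_[p]) ^ k) * B := by
    rw [← iwasawaToPowerSeries_C_natCast_pow p (mu h), ← map_mul, ← hg', hι]
  have hC0 : (p : ℚ_[p]) ^ mu h ≠ 0 := pow_ne_zero _ hpQ
  calc iwasawaToPowerSeries p (fE * pfree h)
      = PowerSeries.C (((p : ℚ_[p]) ^ mu h)⁻¹) *
          (PowerSeries.C ((p : ℚ_[p]) ^ mu h) * iwasawaToPowerSeries p (fE * pfree h)) := by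
        rw [← mul_assoc, ← map_mul, inv_mul_cancel₀ hC0, map_one, one_mul]
    _ = PowerSeries.C (((p : ℚ_[p]) ^ mu h)⁻¹) * (PowerSeries.C ((p : ℚ_[p]) ^ k) * B) := by
        rw [hιeq]
    _ = PowerSeries.C ((p : ℚ_[p]) ^ ((k : ℤ) - mu h)) * B := by
        rw [← mul_assoc, ← map_mul, zpow_sub₀ hpQ, zpow_natCast, zpow_natCast, div_eq_mul_inv,
          mul_comm (((p : ℚ_[p]) ^ mu h)⁻¹)]

/-- **The exponent of the rational main conjecture is `μ(X) + c`.** In the setting of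
`exists_span_eq_and_iota_eq_zpow_of_lam_eq`, if `B` is bounded by `p^c` and ATTAINS the bound, then
`k − μ(h) = μ(fE) + c` and **`ι(fE·H) = p^{μ(fE) + c}·B`**: the INTEGRAL E-normalised equality
`(fE) = (ι⁻¹(p^c·B))` holds iff moreover `μ(fE) = 0`. [cite: GreenbergVatsal2000, p. 4]
[cite: Washington1997, §7.1] -/
theorem iota_eq_pow_mu_add_of_lam_eq {fE h g : IwasawaAlgebra p} (hfac : g = fE * h) (hg : g ≠ 0)
    {k c : ℕ} {B : PowerSeries ℚ_[p]}
    (hι : iwasawaToPowerSeries p g = PowerSeries.C ((p : ℚ_[p]) ^ k) * B)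
    (hbd : ∀ j : ℕ, ‖PowerSeries.coeff j B‖ ≤ (p : ℝ) ^ c)
    {n : ℕ} (hn : ‖PowerSeries.coeff n B‖ = (p : ℝ) ^ c) (hlam : lam fE = lam g) :
    (k : ℤ) - mu h = mu fE + c ∧
      iwasawaToPowerSeries p (fE * pfree h) = PowerSeries.C ((p : ℚ_[p]) ^ (mu fE + c)) * B := by
  have hfE : fE ≠ 0 := by intro h0; apply hg; rw [hfac, h0, zero_mul]
  have hh : h ≠ 0 := by intro h0; apply hg; rw [hfac, h0, mul_zero]
  have hk : mu g + c = k := TameBranchExtraZeros.mu_add_eq_of_iota_eq hg hι hbd hn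
  have hμ : mu g = mu fE + mu h := by rw [hfac]; exact mu_mul hfE hh
  have hexp : (k : ℤ) - mu h = mu fE + c := by omega
  refine ⟨hexp, ?_⟩
  obtain ⟨-, -, -, -, hιG⟩ := exists_span_eq_and_iota_eq_zpow_of_lam_eq hfac hg hι hlam
  rw [hιG, hexp]
  norm_cast

/-- **Converse: the rational main-conjecture shape forces the λ-part and pins the exponent.** If
`(G) = (fE)` (`fE ≠ 0`), `ι G = p^k·B` with `k ∈ ℤ`, `B` bounded by `p^c` with FIRST TOP at `n`, then
**`λ(fE) = n`** (`= λ_an`) and **`k = μ(fE) + c`** (so `k ≥ 0`, and `k = c` iff `μ(fE) = 0`).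
[cite: GreenbergVatsal2000, p. 4] [cite: Washington1997, §7.1] -/
theorem lam_eq_and_exponent_eq_of_span_eq_of_iota_eq_zpow {fE G : IwasawaAlgebra p} (hfE : fE ≠ 0)
    (hspan : Ideal.span ({G} : Set (IwasawaAlgebra p)) = Ideal.span {fE}) {k : ℤ} {c : ℕ}
    {B : PowerSeries ℚ_[p]}
    (hι : iwasawaToPowerSeries p G = PowerSeries.C ((p : ℚ_[p]) ^ k) * B)
    (hbd : ∀ j : ℕ, ‖PowerSeries.coeff j B‖ ≤ (p : ℝ) ^ c)
    {n : ℕ} (hn : ‖PowerSeries.coeff n B‖ = (p : ℝ) ^ c)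
    (hlt : ∀ i < n, ‖PowerSeries.coeff i B‖ < (p : ℝ) ^ c) :
    lam fE = n ∧ k = mu fE + c := by
  have hpQ : (p : ℚ_[p]) ≠ 0 := Nat.cast_ne_zero.mpr hp.out.ne_zero
  -- `G·u = fE` with `u ∈ Λˣ`: same `μ`, same `λ`
  obtain ⟨u, hu⟩ := Ideal.span_singleton_eq_span_singleton.mp hspan
  have hG0 : G ≠ 0 := by intro h0; apply hfE; rw [← hu, h0, zero_mul]
  have hu0 : (u : IwasawaAlgebra p) ≠ 0 := u.ne_zero
  obtain ⟨-, hμu, hlamu⟩ := (isUnit_iff_mu_eq_zero_and_lam_eq_zero (u : IwasawaAlgebra p)).mp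
    (Units.isUnit u)
  have hlamfE : lam fE = lam G := by rw [← hu, lam_mul hG0 hu0, hlamu, add_zero]
  have hμfE : mu fE = mu G := by rw [← hu, mu_mul hG0 hu0, hμu, add_zero]
  rw [hlamfE, hμfE]
  obtain ⟨m, rfl | rfl⟩ := Int.eq_nat_or_neg k
  · rw [zpow_natCast] at hι
    exact ⟨TameBranchExtraZeros.lam_eq_of_iota_eq_of_firstTop hG0 hι hbd hn hlt,
      by exact_mod_cast (TameBranchExtraZeros.mu_add_eq_of_iota_eq hG0 hι hbd hn).symm⟩
  · -- `ι(p^m·G) = B`: then `μ(p^m G) + c = 0`, so `m = μ(G) = c = 0`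
    set G' : IwasawaAlgebra p := PowerSeries.C ((p : ℤ_[p]) ^ m) * G with hG'
    have hι' : iwasawaToPowerSeries p G' = PowerSeries.C ((p : ℚ_[p]) ^ 0) * B := by
      rw [hG', map_mul, iwasawaToPowerSeries_C_natCast_pow p m, hι, ← mul_assoc, ← map_mul, zpow_neg,
        zpow_natCast, mul_inv_cancel₀ (pow_ne_zero m hpQ), pow_zero]
    have hG'0 : G' ≠ 0 := mul_ne_zero (C_pow_ne_zero m) hG0
    have hμG' : mu G' = m + mu G := by
      have h1 : red (1 : IwasawaAlgebra p) ≠ 0 := by rw [red, map_one]; exact one_ne_zero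
      have e : (PowerSeries.C ((p : ℤ_[p]) ^ m) : IwasawaAlgebra p) =
          PowerSeries.C ((p : ℤ_[p]) ^ m) * 1 := (mul_one _).symm
      obtain ⟨hμC, -⟩ := mu_eq_and_pfree_eq h1 e
      rw [hG', mu_mul (C_pow_ne_zero m) hG0, hμC]
    have hk0 : mu G' + c = 0 := TameBranchExtraZeros.mu_add_eq_of_iota_eq hG'0 hι' hbd hn
    have hlamG' : lam G' = n := TameBranchExtraZeros.lam_eq_of_iota_eq_of_firstTop hG'0 hι' hbd hn hlt
    rw [hG', lam_C_pow_mul m hG0] at hlamG'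
    refine ⟨hlamG', ?_⟩
    omega

end MainConjShape

/-! ### §3 Greenberg's parity for the tame-branch data: `λ(fE) ≡ rank (mod 2)` -/

section Parity

variable {W : WeierstrassCurve ℚ} [W.IsElliptic] [W.IsGloballyMinimal] {p : ℕ} [hp : Fact p.Prime]

/-- **`λ(char_Λ X(E/ℚ_∞)) ≡ rank_ℤ E(ℚ) (mod 2)`** for every cyclotomic dual datum with `X` torsion and
generator `fE ≠ 0`, once `Ш(E/ℚ)[p^∞]` is finite: Greenberg, LNM 1716, Prop. 3.10 (`p` odd;
`corank_{ℤ_p} Sel_{p^∞}(E/ℚ) ≡ λ(X) (mod 2)`, named fact `h310`, NO reduction hypothesis at `p`), the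
structure theorem `λ(fE) = λ(X)` (`lam_generator_eq_lambdaInvariant`), and `corank Sel_{p^∞}(E/ℚ) = rank`
for finite `Ш[p^∞]`. On the tame-branch route `X` torsion is Delbourgo 2002 (A) and the finiteness is
(B) clause 2 (parts 2–3). [cite: GreenbergLNM1716, Prop. 3.10 (end of §3)] -/
theorem lam_generator_mod_two_eq_rank (h310 : prop310_selmerCorank_mod_two_eq_lambdaInvariant)
    (hp2 : p ≠ 2) {κ : ZpExtension ℚ p} {γ : Field.absoluteGaloisGroup ℚ}
    (hκ : κ.IsCyclotomic) (hγ : κ.IsTopGenerator γ)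
    (D : W.SelmerDualData κ γ) [Module.Finite (IwasawaAlgebra p) D.X] (hX : D.IsTorsion)
    {fE : IwasawaAlgebra p} (hfE : fE ≠ 0) (hchar : D.charIdeal = Ideal.span {fE})
    (hfin : Finite (AddCommGroup.primaryComponent W.sha p)) :
    lam fE % 2 = W.mordellWeilRank % 2 := by
  rw [lam_generator_eq_lambdaInvariant D.X hX hfE hchar,
    ← selmerCorank_eq_mordellWeilRank_of_finite_shaPrimary W p hfin]
  exact (h310 W p hp2 κ γ hκ hγ D hX).symm

/-- Rank one: `λ(fE)` is ODD. [cite: GreenbergLNM1716, Prop. 3.10] -/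
theorem odd_lam_generator_of_rank_one (h310 : prop310_selmerCorank_mod_two_eq_lambdaInvariant)
    (hp2 : p ≠ 2) (hr1 : W.mordellWeilRank = 1) {κ : ZpExtension ℚ p}
    {γ : Field.absoluteGaloisGroup ℚ} (hκ : κ.IsCyclotomic) (hγ : κ.IsTopGenerator γ)
    (D : W.SelmerDualData κ γ) [Module.Finite (IwasawaAlgebra p) D.X] (hX : D.IsTorsion)
    {fE : IwasawaAlgebra p} (hfE : fE ≠ 0) (hchar : D.charIdeal = Ideal.span {fE})
    (hfin : Finite (AddCommGroup.primaryComponent W.sha p)) : Odd (lam fE) := by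
  have e := lam_generator_mod_two_eq_rank h310 hp2 hκ hγ D hX hfE hchar hfin
  rw [hr1] at e
  exact Nat.odd_iff.mpr e

/-- Rank zero: `λ(fE)` is EVEN. [cite: GreenbergLNM1716, Prop. 3.10] -/
theorem even_lam_generator_of_rank_zero (h310 : prop310_selmerCorank_mod_two_eq_lambdaInvariant)
    (hp2 : p ≠ 2) (hr0 : W.mordellWeilRank = 0) {κ : ZpExtension ℚ p}
    {γ : Field.absoluteGaloisGroup ℚ} (hκ : κ.IsCyclotomic) (hγ : κ.IsTopGenerator γ)
    (D : W.SelmerDualData κ γ) [Module.Finite (IwasawaAlgebra p) D.X] (hX : D.IsTorsion)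
    {fE : IwasawaAlgebra p} (hfE : fE ≠ 0) (hchar : D.charIdeal = Ideal.span {fE})
    (hfin : Finite (AddCommGroup.primaryComponent W.sha p)) : Even (lam fE) := by
  have e := lam_generator_mod_two_eq_rank h310 hp2 hκ hγ D hX hfE hchar hfin
  rw [hr0] at e
  exact Nat.even_iff.mpr e

end Parity

end TameBranchLambdaParity

end Summit.BirchSwinnertonDyer.Rank1Residual.Additive

end
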